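import Literature.Computability.Complexity.RandomKSatPairPolyBasic
import Literature.Computability.Complexity.RandomKSatBalanceRoot
import Literature.Computability.Complexity.RandomKSatPairPolyNearHalf
import Literature.Computability.Complexity.RandomKSatPairPolyNearOne
import Literature.Computability.Complexity.RandomKSatPhiLowerBound
import HarnessLib

/-!
# Achlioptas–Peres, Lemma 8: the second-moment exponent is dominated by its value at `1/2`

Assembly of the analytic part of AP2004 (D. Achlioptas, Y. Peres, J. Amer. Math. Soc. 17 (2004);
arXiv:cs/0305009), Lemma 8 (p. 16): *with `ξ(α) = ε₀` on `[1/10, 9/10]` and `ε₀/2` otherwise,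
for `k ≥ 166` and `r ≤ ρ_k`, `g_r(1/2, ε₀) > g_r(α, ξ(α))` for all `α ≠ 1/2`, and `g_r'' < 0` at
`1/2`* — in the quantitative form consumed by the Laplace bound
`Literature.Combinatorics.sum_choose_mul_pow_le_two_pow`: with
`q(α) = min(F_{λ₀}(α), ρ^k F_{λ₁}(α)) / F_{λ₀}(1/2)` (`ρ = λ₀/λ₁`, `λ₀ = 1 - ε₀`, `λ₁ = 1 - ε₀/2`;
the `min` is the "`inf_{ε ≤ ε₀}`" of AP (50) restricted to the two values actually used), there is
`κ > 0` with `q(α)^r ≤ exp(spinRate(2α-1) - κ(2α-1)²)` for all `α ∈ [0,1]` and all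
`0 ≤ r ≤ L_k - δ_k - 1`, `L_k = 2^k log 2 - (k+1) log 2/2 - 1`,
`δ_k = 15k²/2^k + E_k` (`E_k` of `RandomKSatPairPolyNearOne.lean`). We take `k ≥ 1024`
(AP: `k ≥ 166`; only the existence of some `k₀` matters downstream).

Ingredients: Option A on `[1/2, 9/10]` (`pairPoly_div_rpow_le_exp_near_half`, with the
curvature hypothesis discharged here: `curvature_le` — AP (32)–(33) with `9/10`, Corollary 2),
Option B on `[9/10, 1]` (`optionB_of_le` + `phi_lower_bound`), AP Lemma 4 for `α < 1/2`
(`pairPoly_half_sub_le_half_add`), and the balancing root (`exists_balance_eps`).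

## Results (all proved)

* `three_mul_sq_le_pow` (`3k² ≤ (10/9)^k`, `k ≥ 100`), `pairPoly_half_ge` (`F_{λ₀}(1/2) ≥ 2^k/4`),
  `curvature_le` (`r F'' ≤ 2F` on `[1/2, 9/10]` for `r ≤ 2^k log 2`, `k ≥ 100`);
* `optionB_bound_ge` — `L_k - δ_k ≤ S((1-ε₁)^k(B - αC) - E_k)` on `[9/10, 1]` (from
  `phi_lower_bound`); `optionB_rpow_le` — Option B exponentiated with the margin
  `κ ≤ (3/10) δ_k/(L_k - δ_k)` for `r ≤ L_k - 2δ_k`; numerical facts `pow_81_50_ge`,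
  `pow_9_5_ge`, `errorE_le_three` (`E_k ≤ 3`);
* `domination` — the statement above (AP Lemma 8, quantitative), for `0 ≤ r ≤ L_k - 2δ_k`.
-/

noncomputable section

namespace Literature.Computability.Complexity

open Set Real Literature.Probability.LatticeModels

namespace RandomKSat

/-! ### Curvature on `[1/2, 9/10]` (AP Corollary 2) -/

/-- `3k² ≤ (10/9)^k` for `k ≥ 100` (so `k² (9/10)^k ≤ 1/3`). [folklore] -/
theorem three_mul_sq_le_pow {k : ℕ} (hk : 100 ≤ k) : 3 * (k : ℝ) ^ 2 ≤ (10 / 9) ^ k := by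
  have h : ∀ n : ℕ, 3 * ((n + 100 : ℕ) : ℝ) ^ 2 ≤ (10 / 9) ^ (n + 100) := by
    intro n
    induction n with
    | zero => norm_num
    | succ n ih =>
      have e : ((10 : ℝ) / 9) ^ (n + 1 + 100) = 10 / 9 * (10 / 9) ^ (n + 100) := by ring
      rw [e]
      push_cast at ih ⊢
      have hn : (0 : ℝ) ≤ n := Nat.cast_nonneg n
      nlinarith [ih]
  obtain ⟨n, rfl⟩ : ∃ n, k = n + 100 := ⟨k - 100, by omega⟩
  exact h n

/-- `F_{λ₀}(1/2) ≥ 2^k/4` for `λ₀ = 1 - ε₀`, `ε₀ ≤ 4/2^k`, `k ≥ 5`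
(`2^k F(1/2) = ((2-ε₀)^k - 1)²` and `(2-ε₀)^k ≥ 2^k - 2k`). [cite: AchlioptasPeres2004, eq. (35) p. 13] -/
theorem pairPoly_half_ge {k : ℕ} (hk : 5 ≤ k) {ε₀ : ℝ} (h4 : ε₀ ≤ 4 / 2 ^ k) :
    2 ^ k / 4 ≤ pairPoly k (1 - ε₀) (1 / 2) := by
  have h2k : (0 : ℝ) < 2 ^ k := pow_pos two_pos k
  have h16 := four_mul_le_two_pow (by omega : 4 ≤ k)
  have hk' : (5 : ℝ) ≤ k := by exact_mod_cast hk
  -- `8(k-1) ≤ 2^k`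
  have h8 : 8 * ((k : ℝ) - 1) ≤ 2 ^ k := by
    have h := four_mul_le_two_pow (show 4 ≤ k - 1 by omega)
    have e1 : ((k - 1 : ℕ) : ℝ) = (k : ℝ) - 1 := by push_cast [Nat.cast_sub (by omega : 1 ≤ k)]; ring
    rw [e1] at h
    have e2 : (2 : ℝ) ^ k = 2 * 2 ^ (k - 1) := by
      rw [← pow_succ']; congr 1; omega
    rw [e2]; linarith
  rw [← mul_le_mul_iff_right₀ h2k, pairPoly_half']
  have e : (1 : ℝ) + (1 - ε₀) = 2 - ε₀ := by ring
  rw [e]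
  -- `(2-ε₀)^k ≥ (2 - 4/2^k)^k = 2^k (1 - 2/2^k)^k ≥ 2^k (1 - 2k/2^k) = 2^k - 2k`
  have hbase : 2 - 4 / 2 ^ k ≤ 2 - ε₀ := by linarith
  have hbase0 : 0 ≤ 2 - 4 / (2 : ℝ) ^ k := by
    rw [sub_nonneg, div_le_iff₀ h2k]; linarith
  have hpow : (2 - 4 / 2 ^ k) ^ k ≤ (2 - ε₀) ^ k := pow_le_pow_left₀ hbase0 hbase k
  have hbern : (2 : ℝ) ^ k - 2 * k ≤ (2 - 4 / 2 ^ k) ^ k := by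
    have e2 : (2 : ℝ) - 4 / 2 ^ k = 2 * (1 - 2 / 2 ^ k) := by ring
    rw [e2, mul_pow]
    have h := one_add_mul_le_pow (show (-2 : ℝ) ≤ -(2 / 2 ^ k) by
      have : (2 : ℝ) / 2 ^ k ≤ 2 / 16 := div_le_div_of_nonneg_left (by norm_num) (by norm_num) (by linarith)
      linarith) k
    have e3 : (1 : ℝ) + -(2 / 2 ^ k) = 1 - 2 / 2 ^ k := by ring
    rw [e3] at h
    have e4 : (2 : ℝ) ^ k * (1 + k * -(2 / 2 ^ k)) = 2 ^ k - 2 * k := by field_simp; ring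
    calc (2 : ℝ) ^ k - 2 * k = 2 ^ k * (1 + k * -(2 / 2 ^ k)) := e4.symm
      _ ≤ 2 ^ k * (1 - 2 / 2 ^ k) ^ k := mul_le_mul_of_nonneg_left h h2k.le
  have hc0 : (2 : ℝ) ^ k / 2 ≤ (2 - ε₀) ^ k - 1 := by linarith
  have hc0' : 0 ≤ (2 : ℝ) ^ k / 2 := by positivity
  calc (2 : ℝ) ^ k * (2 ^ k / 4) = (2 ^ k / 2) ^ 2 := by ring
    _ ≤ ((2 - ε₀) ^ k - 1) ^ 2 := pow_le_pow_left₀ hc0' hc0 2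

/-- **Curvature on `[1/2, 9/10]`** (AP (32)–(33) with `9/10`, i.e. Corollary 2): for `k ≥ 100`,
`λ₀ = 1 - ε₀` with `0 ≤ ε₀ ≤ 4/2^k`, and `0 ≤ r ≤ 2^k log 2`, `r F''(a) ≤ 2 F(a)` for
`a ∈ [1/2, 9/10]`. [cite: AchlioptasPeres2004, eq. (32)–(33) p. 12 and Corollary 2] -/
theorem curvature_le {k : ℕ} (hk : 100 ≤ k) {ε₀ : ℝ} (h0 : 0 ≤ ε₀) (h4 : ε₀ ≤ 4 / 2 ^ k) {r : ℝ}
    (hr0 : 0 ≤ r) (hr : r ≤ 2 ^ k * Real.log 2) {a : ℝ} (ha : a ∈ Icc (1 / 2 : ℝ) (9 / 10)) :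
    r * ((k : ℝ) * (k - 1 : ℕ) * ((1 - (1 - ε₀)) ^ 4 * (2 * (1 - ε₀) + a * (1 - (1 - ε₀)) ^ 2) ^ (k - 2) -
        2 * (1 - (1 - ε₀)) ^ 2 * ((1 - ε₀) + a * (1 - (1 - ε₀))) ^ (k - 2) + a ^ (k - 2))) ≤
      2 * pairPoly k (1 - ε₀) a := by
  have h2k : (0 : ℝ) < 2 ^ k := pow_pos two_pos k
  have hk' : (100 : ℝ) ≤ k := by exact_mod_cast hk
  have h16 : 16 * (k : ℝ) ≤ 2 ^ k := sixteen_mul_le_two_pow (by omega)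
  have hl2 : Real.log 2 < 0.6931471808 := Real.log_two_lt_d9
  have hε1 : ε₀ ≤ 1 := by
    have : (4 : ℝ) / 2 ^ k ≤ 4 / 1600 := div_le_div_of_nonneg_left (by norm_num) (by norm_num) (by linarith)
    linarith
  -- `F(a) ≥ F(1/2) ≥ 2^k/4`
  have hF : 2 ^ k / 4 ≤ pairPoly k (1 - ε₀) a := by
    have h := pairPoly_half_le_of_nonneg k (1 - ε₀) (x := a - 1 / 2) (by linarith [ha.1])
    rw [show 1 / 2 + (a - 1 / 2) = a by ring] at h
    exact (pairPoly_half_ge (by omega) h4).trans h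
  -- `F''(a) ≤ k² (ε₀⁴ 2^{k-2} + a^{k-2}) ≤ k² (ε₀⁴ 2^{k-2} + (9/10)^{k-2})`
  have hD2 := pairPolyD2_le (k := k) (by omega) (lam := 1 - ε₀) (by linarith) (by linarith) (α := a)
    (by linarith [ha.1]) (by linarith [ha.2])
  rw [show (1 : ℝ) - (1 - ε₀) = ε₀ by ring] at hD2 ⊢
  have hak : a ^ (k - 2) ≤ (9 / 10) ^ (k - 2) := pow_le_pow_left₀ (by linarith [ha.1]) ha.2 _
  -- numeric: `log 2 · k² (ε₀⁴ 2^{k-2} + (9/10)^{k-2}) ≤ 1/2`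
  have h910 : (k : ℝ) ^ 2 * (9 / 10) ^ (k - 2) ≤ 100 / 243 := by
    -- `k² (9/10)^k ≤ 1/3` and `(9/10)^{k-2} = (9/10)^k · (100/81)`
    have h3 := three_mul_sq_le_pow hk
    have hsplit : ((9 : ℝ) / 10) ^ k = (9 / 10) ^ (k - 2) * (81 / 100) := by
      rw [show ((81 : ℝ) / 100) = (9 / 10) ^ 2 by norm_num, ← pow_add]
      congr 1; omega
    have e : ((9 : ℝ) / 10) ^ (k - 2) = (9 / 10) ^ k * (100 / 81) := by
      rw [hsplit]; ring
    rw [e]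
    have hp : ((9 : ℝ) / 10) ^ k * (10 / 9) ^ k = 1 := by rw [← mul_pow]; norm_num
    have hpos : (0 : ℝ) < (10 / 9) ^ k := by positivity
    have : (k : ℝ) ^ 2 * (9 / 10) ^ k ≤ 1 / 3 := by
      rw [← hp]
      have : (k : ℝ) ^ 2 ≤ 1 / 3 * (10 / 9) ^ k := by linarith
      calc (k : ℝ) ^ 2 * (9 / 10) ^ k ≤ 1 / 3 * (10 / 9) ^ k * (9 / 10) ^ k :=
            mul_le_mul_of_nonneg_right this (by positivity)
        _ = (9 / 10) ^ k * (10 / 9) ^ k * (1 / 3) := by ring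
        _ = 1 / 3 * ((9 / 10) ^ k * (10 / 9) ^ k) := by ring
        _ = _ := by rw [hp]; ring
      -- (the last two steps only reorder)
    nlinarith
  have hε4 : (k : ℝ) ^ 2 * (ε₀ ^ 4 * 2 ^ (k - 2)) ≤ 1 / 100 := by
    -- `ε₀⁴ 2^{k-2} ≤ (4/2^k)⁴ 2^k = 256/(2^k)³ ≤ 256/(16k)³`
    have hε4' : ε₀ ^ 4 ≤ (4 / 2 ^ k) ^ 4 := pow_le_pow_left₀ h0 h4 4
    have h2k2 : (2 : ℝ) ^ (k - 2) ≤ 2 ^ k := pow_le_pow_right₀ (by norm_num) (by omega)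
    have h1 : ε₀ ^ 4 * 2 ^ (k - 2) ≤ (4 / 2 ^ k) ^ 4 * 2 ^ k :=
      mul_le_mul hε4' h2k2 (by positivity) (by positivity)
    have h2 : (k : ℝ) ^ 2 * ((4 / 2 ^ k) ^ 4 * 2 ^ k) ≤ 1 / 100 := by
      rw [div_pow]
      have e : (k : ℝ) ^ 2 * (4 ^ 4 / (2 ^ k) ^ 4 * 2 ^ k) = 256 * k ^ 2 / (2 ^ k) ^ 3 := by
        field_simp; ring
      rw [e, div_le_div_iff₀ (by positivity) (by norm_num)]
      have h3 : (16 * (k : ℝ)) ^ 3 ≤ (2 ^ k) ^ 3 := pow_le_pow_left₀ (by positivity) h16 3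
      nlinarith [h3]
    calc (k : ℝ) ^ 2 * (ε₀ ^ 4 * 2 ^ (k - 2)) ≤ k ^ 2 * ((4 / 2 ^ k) ^ 4 * 2 ^ k) :=
          mul_le_mul_of_nonneg_left h1 (by positivity)
      _ ≤ 1 / 100 := h2
  -- combine
  have hmid : 0 ≤ 2 * ε₀ ^ 2 * ((1 - ε₀) + a * ε₀) ^ (k - 2) := by
    have : 0 ≤ (1 - ε₀) + a * ε₀ := by nlinarith [ha.1]
    positivity
  have hbracket : (k : ℝ) * (k - 1 : ℕ) * (ε₀ ^ 4 * (2 * (1 - ε₀) + a * ε₀ ^ 2) ^ (k - 2) -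
        2 * ε₀ ^ 2 * ((1 - ε₀) + a * ε₀) ^ (k - 2) + a ^ (k - 2)) ≤
      (k : ℝ) ^ 2 * (ε₀ ^ 4 * 2 ^ (k - 2)) + k ^ 2 * (9 / 10) ^ (k - 2) := by
    have := hD2
    nlinarith [mul_le_mul_of_nonneg_left hak (by positivity : (0 : ℝ) ≤ k ^ 2)]
  by_cases hsign : (k : ℝ) * (k - 1 : ℕ) * (ε₀ ^ 4 * (2 * (1 - ε₀) + a * ε₀ ^ 2) ^ (k - 2) -
      2 * ε₀ ^ 2 * ((1 - ε₀) + a * ε₀) ^ (k - 2) + a ^ (k - 2)) ≤ 0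
  · have : r * ((k : ℝ) * (k - 1 : ℕ) * (ε₀ ^ 4 * (2 * (1 - ε₀) + a * ε₀ ^ 2) ^ (k - 2) -
        2 * ε₀ ^ 2 * ((1 - ε₀) + a * ε₀) ^ (k - 2) + a ^ (k - 2))) ≤ 0 :=
      mul_nonpos_of_nonneg_of_nonpos hr0 hsign
    linarith [hF, h2k]
  · push Not at hsign
    calc r * ((k : ℝ) * (k - 1 : ℕ) * (ε₀ ^ 4 * (2 * (1 - ε₀) + a * ε₀ ^ 2) ^ (k - 2) -
          2 * ε₀ ^ 2 * ((1 - ε₀) + a * ε₀) ^ (k - 2) + a ^ (k - 2)))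
        ≤ (2 ^ k * Real.log 2) * ((k : ℝ) ^ 2 * (ε₀ ^ 4 * 2 ^ (k - 2)) + k ^ 2 * (9 / 10) ^ (k - 2)) :=
          mul_le_mul hr hbracket hsign.le (by positivity)
      _ ≤ (2 ^ k * Real.log 2) * (1 / 100 + 100 / 243) := by
          apply mul_le_mul_of_nonneg_left _ (by positivity); linarith
      _ ≤ 2 * (2 ^ k / 4) := by nlinarith [h2k]
      _ ≤ 2 * pairPoly k (1 - ε₀) a := by linarith

/-! ### Option B: the allowed density (AP: `r ≤ ρ_k`) -/

set_option maxHeartbeats 400000 in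
-- many explicit estimates in one declaration
/-- **From `φ_min` to the density**: for `k ≥ 1024`, the balancing `ε₀`
(`2/2^k ≤ ε₀ ≤ 2/2^k + 8k/4^k`) and `α ∈ [9/10, 1]`,
`L_k - δ_k ≤ S(α) ((1-ε₁)^k (B - αC) - E_k)` with `L_k = 2^k log 2 - (k+1) log 2/2 - 1`,
`δ_k = 15k²/2^k + E_k` (so every `r ≤ L_k - δ_k` satisfies the hypothesis of `optionB_of_le`):
`(1-ε₁)^k ≥ 1 - k/2^k - 4k²/4^k`, `S(B - αC) ≥ 2^k log 2 + (k-1) log 2/2 - 1 - 10k²/2^k`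
(`phi_lower_bound`) and `S ≤ log 2`. [cite: AchlioptasPeres2004, end of §9 p. 21 ("(1-ε₁)^k φ_min > ρ_k")] -/
theorem optionB_bound_ge {k : ℕ} (hk : 1024 ≤ k) {ε₀ : ℝ} (hε₀l : 2 / 2 ^ k ≤ ε₀)
    (hε₀u : ε₀ ≤ 2 / 2 ^ k + 8 * k / 4 ^ k) {α : ℝ} (hα : 9 / 10 ≤ α) (hα1 : α ≤ 1) :
    (2 ^ k * Real.log 2 - (k + 1) * Real.log 2 / 2 - 1) -
        (15 * k ^ 2 / 2 ^ k + ((k + 3) / 2 ^ k + 32 * k ^ 2 * (50 / 81) ^ k + 32 * k * (5 / 9) ^ k)) ≤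
      spinRate (2 * α - 1) * ((1 - ε₀ / 2) ^ k * ((2 ^ k * (k + 1) - 3 * k - 1 / 2) - α * (k * (2 ^ k - 7 / 2))) -
        ((k + 3) / 2 ^ k + 32 * k ^ 2 * (50 / 81) ^ k + 32 * k * (5 / 9) ^ k)) := by
  have h2k : (0 : ℝ) < 2 ^ k := pow_pos two_pos k
  have h4k : (4 : ℝ) ^ k = 2 ^ k * 2 ^ k := by rw [← mul_pow]; norm_num
  have hk' : (1024 : ℝ) ≤ k := by exact_mod_cast hk
  have hkpos : (0 : ℝ) < k := by linarith
  have h16 : 16 * (k : ℝ) ≤ 2 ^ k := sixteen_mul_le_two_pow (by omega)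
  have hk3 := cube_le_two_pow (by omega : 10 ≤ k)
  have hl2 : Real.log 2 < 0.6931471808 := Real.log_two_lt_d9
  have hl2l : 0.6931471803 < Real.log 2 := Real.log_two_gt_d9
  -- the three factors
  set S := spinRate (2 * α - 1) with hSdef
  set P := (2 ^ k * ((k : ℝ) + 1) - 3 * k - 1 / 2) - α * (k * (2 ^ k - 7 / 2)) with hPdef
  set E := ((k : ℝ) + 3) / 2 ^ k + 32 * k ^ 2 * (50 / 81) ^ k + 32 * k * (5 / 9) ^ k with hEdef
  set M := 2 ^ k * Real.log 2 + ((k : ℝ) - 1) * Real.log 2 / 2 - 1 - 10 * k ^ 2 / 2 ^ k with hMdef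
  have hphi : M ≤ S * P := phi_lower_bound hk hα hα1
  have hS0 : 0 ≤ S := le_trans (by linarith) (spinRate_two_mul_sub_one_ge hα hα1)
  have hSle : S ≤ Real.log 2 := by
    rw [hSdef, spinRate_two_mul_sub_one]
    linarith [Real.binEntropy_nonneg (p := α) (by linarith) hα1]
  have hE0 : 0 ≤ E := by positivity
  have hM0 : 0 ≤ M := by
    rw [hMdef]
    have : 10 * (k : ℝ) ^ 2 / 2 ^ k ≤ 1 := by
      rw [div_le_one h2k]; nlinarith
    nlinarith [mul_nonneg (sub_nonneg.2 hl2l.le) h2k.le]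
  -- `(1-ε₁)^k ≥ 1 - θ`, `θ = k/2^k + 4k²/4^k`
  have hε₀4 : ε₀ ≤ 4 / 2 ^ k := by
    have h1 : 8 * (k : ℝ) / 4 ^ k ≤ 2 / 2 ^ k := by
      rw [h4k, div_le_div_iff₀ (by positivity) h2k]; nlinarith [h16, h2k]
    have e : (4 : ℝ) / 2 ^ k = 2 / 2 ^ k + 2 / 2 ^ k := by ring
    linarith
  have hε₀ : 0 < ε₀ := lt_of_lt_of_le (by positivity) hε₀l
  set θ : ℝ := k / 2 ^ k + 4 * k ^ 2 / 4 ^ k with hθdef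
  have hε₀4' : ε₀ ≤ 1 := by
    have : (4 : ℝ) / 2 ^ k ≤ 1 := by
      rw [div_le_one h2k]; linarith
    linarith
  have hbern : 1 - θ ≤ (1 - ε₀ / 2) ^ k := by
    have h := one_add_mul_le_pow (show (-2 : ℝ) ≤ -(ε₀ / 2) by linarith) k
    have e1 : (1 : ℝ) + -(ε₀ / 2) = 1 - ε₀ / 2 := by ring
    rw [e1] at h
    have hθ : k * (ε₀ / 2) ≤ θ := by
      rw [hθdef]
      have := mul_le_mul_of_nonneg_left hε₀u (by positivity : (0 : ℝ) ≤ k / 2)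
      have e2 : (k : ℝ) / 2 * (2 / 2 ^ k + 8 * k / 4 ^ k) = k / 2 ^ k + 4 * k ^ 2 / 4 ^ k := by
        field_simp; ring
      have e3 : (k : ℝ) * (ε₀ / 2) = k / 2 * ε₀ := by ring
      linarith [e2, e3]
    have e4 : (1 : ℝ) + k * -(ε₀ / 2) = 1 - k * (ε₀ / 2) := by ring
    rw [e4] at h
    linarith
  have ht1 : (1 - ε₀ / 2) ^ k ≤ 1 := pow_le_one₀ (by linarith) (by linarith)
  -- `θ M ≤ k log 2 + 5k²/2^k`
  have hθM : θ * M ≤ k * Real.log 2 + 5 * k ^ 2 / 2 ^ k := by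
    rw [hθdef, hMdef, h4k]
    have hMle : 2 ^ k * Real.log 2 + ((k : ℝ) - 1) * Real.log 2 / 2 - 1 - 10 * k ^ 2 / 2 ^ k ≤
        2 ^ k * Real.log 2 + k * Real.log 2 / 2 := by
      have : 0 ≤ 10 * (k : ℝ) ^ 2 / 2 ^ k := by positivity
      nlinarith
    have hθ0 : 0 ≤ (k : ℝ) / 2 ^ k + 4 * k ^ 2 / (2 ^ k * 2 ^ k) := by positivity
    calc ((k : ℝ) / 2 ^ k + 4 * k ^ 2 / (2 ^ k * 2 ^ k)) *
          (2 ^ k * Real.log 2 + (k - 1) * Real.log 2 / 2 - 1 - 10 * k ^ 2 / 2 ^ k)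
        ≤ (k / 2 ^ k + 4 * k ^ 2 / (2 ^ k * 2 ^ k)) * (2 ^ k * Real.log 2 + k * Real.log 2 / 2) :=
          mul_le_mul_of_nonneg_left hMle hθ0
      _ = k * Real.log 2 + (k ^ 2 / 2 + 4 * k ^ 2 + 2 * k ^ 3 / 2 ^ k) * Real.log 2 / 2 ^ k := by
          field_simp; ring
      _ ≤ k * Real.log 2 + 5 * k ^ 2 / 2 ^ k := by
          have h1 : 2 * (k : ℝ) ^ 3 / 2 ^ k ≤ k ^ 2 / 2 := by
            rw [div_le_iff₀ h2k]; nlinarith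
          have h2 : ((k : ℝ) ^ 2 / 2 + 4 * k ^ 2 + 2 * k ^ 3 / 2 ^ k) * Real.log 2 ≤ 5 * k ^ 2 := by
            nlinarith
          have := div_le_div_of_nonneg_right h2 h2k.le
          linarith
  -- assemble: `S((1-ε₁)^k P - E) = (1-ε₁)^k (S P) - S E ≥ (1-θ) M - E log 2`
  calc (2 ^ k * Real.log 2 - (k + 1) * Real.log 2 / 2 - 1) - (15 * k ^ 2 / 2 ^ k + E)
      = M - (k * Real.log 2 + 5 * k ^ 2 / 2 ^ k) - E := by rw [hMdef]; ring
    _ ≤ M - θ * M - E * Real.log 2 := by nlinarith [hθM, hE0]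
    _ = (1 - θ) * M - E * Real.log 2 := by ring
    _ ≤ (1 - ε₀ / 2) ^ k * (S * P) - S * E := by
        have h1 : (1 - θ) * M ≤ (1 - ε₀ / 2) ^ k * M := mul_le_mul_of_nonneg_right hbern hM0
        have h2 : (1 - ε₀ / 2) ^ k * M ≤ (1 - ε₀ / 2) ^ k * (S * P) :=
          mul_le_mul_of_nonneg_left hphi (pow_nonneg (by linarith) k)
        have h3 : S * E ≤ Real.log 2 * E := mul_le_mul_of_nonneg_right hSle hE0
        linarith
    _ = S * ((1 - ε₀ / 2) ^ k * P - E) := by ring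

/-! ### Two more numerical facts -/

/-- `32k² ≤ (81/50)^k` for `k ≥ 30`. [folklore] -/
theorem pow_81_50_ge {k : ℕ} (hk : 30 ≤ k) : 32 * (k : ℝ) ^ 2 ≤ (81 / 50) ^ k := by
  have h : ∀ n : ℕ, 32 * ((n + 30 : ℕ) : ℝ) ^ 2 ≤ (81 / 50) ^ (n + 30) := by
    intro n
    induction n with
    | zero => norm_num
    | succ n ih =>
      have e : ((81 : ℝ) / 50) ^ (n + 1 + 30) = 81 / 50 * (81 / 50) ^ (n + 30) := by ring
      rw [e]; push_cast at ih ⊢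
      have hn : (0 : ℝ) ≤ n := Nat.cast_nonneg n
      nlinarith [ih]
  obtain ⟨n, rfl⟩ : ∃ n, k = n + 30 := ⟨k - 30, by omega⟩
  exact h n

/-- `32k ≤ (9/5)^k` for `k ≥ 10`. [folklore] -/
theorem pow_9_5_ge {k : ℕ} (hk : 10 ≤ k) : 32 * (k : ℝ) ≤ (9 / 5) ^ k := by
  have h : ∀ n : ℕ, 32 * ((n + 10 : ℕ) : ℝ) ≤ (9 / 5) ^ (n + 10) := by
    intro n
    induction n with
    | zero => norm_num
    | succ n ih =>
      have e : ((9 : ℝ) / 5) ^ (n + 1 + 10) = 9 / 5 * (9 / 5) ^ (n + 10) := by ring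
      rw [e]; push_cast at ih ⊢; nlinarith
  obtain ⟨n, rfl⟩ : ∃ n, k = n + 10 := ⟨k - 10, by omega⟩
  exact h n

/-- The error `E_k ≤ 3` and hence `δ_k ≤ 4`, for `k ≥ 30`. [folklore] -/
theorem errorE_le_three {k : ℕ} (hk : 30 ≤ k) :
    ((k : ℝ) + 3) / 2 ^ k + 32 * k ^ 2 * (50 / 81) ^ k + 32 * k * (5 / 9) ^ k ≤ 3 := by
  have h2k : (0 : ℝ) < 2 ^ k := pow_pos two_pos k
  have h16 : 16 * (k : ℝ) ≤ 2 ^ k := sixteen_mul_le_two_pow (by omega)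
  have hk' : (30 : ℝ) ≤ k := by exact_mod_cast hk
  have h1 : ((k : ℝ) + 3) / 2 ^ k ≤ 1 := by rw [div_le_one h2k]; linarith
  have hA := pow_81_50_ge hk
  have hB := pow_9_5_ge (by omega : 10 ≤ k)
  have hpA : ((50 : ℝ) / 81) ^ k * (81 / 50) ^ k = 1 := by rw [← mul_pow]; norm_num
  have hpB : ((5 : ℝ) / 9) ^ k * (9 / 5) ^ k = 1 := by rw [← mul_pow]; norm_num
  have h2 : 32 * (k : ℝ) ^ 2 * (50 / 81) ^ k ≤ 1 := by
    calc 32 * (k : ℝ) ^ 2 * (50 / 81) ^ k ≤ (81 / 50) ^ k * (50 / 81) ^ k :=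
          mul_le_mul_of_nonneg_right hA (by positivity)
      _ = 1 := by rw [mul_comm, hpA]
  have h3 : 32 * (k : ℝ) * (5 / 9) ^ k ≤ 1 := by
    calc 32 * (k : ℝ) * (5 / 9) ^ k ≤ (9 / 5) ^ k * (5 / 9) ^ k :=
          mul_le_mul_of_nonneg_right hB (by positivity)
      _ = 1 := by rw [mul_comm, hpB]
  linarith

/-! ### Option B as an exponent bound -/

set_option maxHeartbeats 400000 in
-- explicit estimates
/-- **Option B, exponentiated with a margin**: for `k ≥ 1024`, the balancing `ε₀`, `β ∈ [9/10, 1]`,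
`0 ≤ r ≤ R₀ - D` where `R₀ = L_k - D`, `D = δ_k = 15k²/2^k + E_k`, and `0 < κ ≤ (3/10) D/R₀`:
`W(β)^r ≤ exp(spinRate(2β-1) - κ(2β-1)²)`, `W = ((1-ε₀)/(1-ε₁))^k F_{λ₁}(β)/F_{λ₀}(1/2)`.
(If `W ≤ 1` this is `1 ≤ exp(S - κ)`; if `W > 1`, `R₀ log W ≤ S` by `optionB_of_le` and
`optionB_bound_ge`, and `r ≤ R₀ - D` gives the margin `S D/R₀ ≥ κ`.)
[cite: AchlioptasPeres2004, Lemma 9 (arXiv:cs/0305009 p. 16)] -/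
theorem optionB_rpow_le {k : ℕ} (hk : 1024 ≤ k) {ε₀ : ℝ} (hbal : ε₀ * (2 - ε₀) ^ (k - 1) = 1)
    (hl : 2 / 2 ^ k ≤ ε₀) (hu : ε₀ ≤ 2 / 2 ^ k + 8 * k / 4 ^ k)
    (hF0h : 0 < pairPoly k (1 - ε₀) (1 / 2)) {β : ℝ} (hβ9 : 9 / 10 ≤ β) (hβ1 : β ≤ 1)
    {r κ : ℝ} (hr0 : 0 ≤ r)
    (hr : r ≤ ((2 ^ k * Real.log 2 - (k + 1) * Real.log 2 / 2 - 1) -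
        (15 * k ^ 2 / 2 ^ k + ((k + 3) / 2 ^ k + 32 * k ^ 2 * (50 / 81) ^ k + 32 * k * (5 / 9) ^ k))) -
        (15 * k ^ 2 / 2 ^ k + ((k + 3) / 2 ^ k + 32 * k ^ 2 * (50 / 81) ^ k + 32 * k * (5 / 9) ^ k)))
    (hκ0 : 0 < κ)
    (hκR : κ ≤ 3 / 10 * (15 * k ^ 2 / 2 ^ k + ((k + 3) / 2 ^ k + 32 * k ^ 2 * (50 / 81) ^ k + 32 * k * (5 / 9) ^ k)) /
        ((2 ^ k * Real.log 2 - (k + 1) * Real.log 2 / 2 - 1) -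
          (15 * k ^ 2 / 2 ^ k + ((k + 3) / 2 ^ k + 32 * k ^ 2 * (50 / 81) ^ k + 32 * k * (5 / 9) ^ k)))) :
    (((1 - ε₀) / (1 - ε₀ / 2)) ^ k * pairPoly k (1 - ε₀ / 2) β / pairPoly k (1 - ε₀) (1 / 2)) ^ r ≤
      Real.exp (spinRate (2 * β - 1) - κ * (2 * β - 1) ^ 2) := by
  have h2k : (0 : ℝ) < 2 ^ k := pow_pos two_pos k
  have hk' : (1024 : ℝ) ≤ k := by exact_mod_cast hk
  have h16 : 16 * (k : ℝ) ≤ 2 ^ k := sixteen_mul_le_two_pow (by omega)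
  have hl2l : 0.6931471803 < Real.log 2 := Real.log_two_gt_d9
  have hε₀ : 0 < ε₀ := lt_of_lt_of_le (by positivity) hl
  have h4k : (4 : ℝ) ^ k = 2 ^ k * 2 ^ k := by rw [← mul_pow]; norm_num
  have hε₀4 : ε₀ ≤ 4 / 2 ^ k := by
    have h1 : 8 * (k : ℝ) / 4 ^ k ≤ 2 / 2 ^ k := by
      rw [h4k, div_le_div_iff₀ (by positivity) h2k]; nlinarith [h16, h2k]
    have e : (4 : ℝ) / 2 ^ k = 2 / 2 ^ k + 2 / 2 ^ k := by ring
    linarith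
  have hε₀1 : ε₀ < 1 := by
    have : (4 : ℝ) / 2 ^ k ≤ 4 / 16384 := div_le_div_of_nonneg_left (by norm_num) (by norm_num) (by linarith)
    linarith
  -- `D`, `R₀`
  set E : ℝ := ((k : ℝ) + 3) / 2 ^ k + 32 * k ^ 2 * (50 / 81) ^ k + 32 * k * (5 / 9) ^ k with hE
  set D : ℝ := 15 * k ^ 2 / 2 ^ k + E with hD
  set R₀ : ℝ := (2 ^ k * Real.log 2 - (k + 1) * Real.log 2 / 2 - 1) - D with hR₀
  have hE3 : E ≤ 3 := errorE_le_three (by omega)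
  have h15 : 15 * (k : ℝ) ^ 2 / 2 ^ k ≤ 1 := by
    rw [div_le_one h2k]; nlinarith [cube_le_two_pow (by omega : 10 ≤ k)]
  have hD0 : 0 < D := by rw [hD]; positivity
  have hR₀2 : 2 ≤ R₀ := by
    rw [hR₀, hD]
    nlinarith [mul_nonneg (sub_nonneg.2 hl2l.le) h2k.le]
  have hR₀pos : 0 < R₀ := by linarith
  have hrR : r ≤ R₀ - D := hr
  -- `W ≥ 0`, `S ≥ 3/10`
  have hρ0 : 0 ≤ ((1 - ε₀) / (1 - ε₀ / 2)) ^ k := pow_nonneg (div_nonneg (by linarith) (by linarith)) k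
  set W : ℝ := ((1 - ε₀) / (1 - ε₀ / 2)) ^ k * pairPoly k (1 - ε₀ / 2) β / pairPoly k (1 - ε₀) (1 / 2)
    with hW
  have hW0 : 0 ≤ W :=
    div_nonneg (mul_nonneg hρ0 (pairPoly_nonneg k (by linarith) (by linarith) hβ1)) hF0h.le
  set S := spinRate (2 * β - 1) with hS
  have hS3 : 3 / 10 ≤ S := le_trans (by linarith) (spinRate_two_mul_sub_one_ge hβ9 hβ1)
  have hS0 : 0 ≤ S := by linarith
  have hx1 : (2 * β - 1) ^ 2 ≤ 1 := by nlinarith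
  have hκ3 : κ ≤ 3 / 10 := by
    have : 3 / 10 * D / R₀ ≤ 3 / 10 := by
      rw [div_le_iff₀ hR₀pos]
      have : D ≤ R₀ := by linarith
      nlinarith
    exact hκR.trans this
  have hexp0 : 1 ≤ Real.exp (S - κ * (2 * β - 1) ^ 2) := by
    apply Real.one_le_exp
    nlinarith [mul_le_mul_of_nonneg_left hx1 hκ0.le]
  by_cases hW1 : W ≤ 1
  · exact (Real.rpow_le_one hW0 hW1 hr0).trans hexp0
  · push Not at hW1
    have hB := optionB_bound_ge hk hl hu hβ9 hβ1
    have hRW : R₀ * Real.log W ≤ S := optionB_of_le (by omega) hbal hl hu hβ9 hβ1 hW1 hS0 hR₀pos.le hB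
    have hlogW : 0 < Real.log W := Real.log_pos hW1
    have h1 : r * Real.log W ≤ r / R₀ * S := by
      have := mul_le_mul_of_nonneg_left hRW (div_nonneg hr0 hR₀pos.le)
      calc r * Real.log W = r / R₀ * (R₀ * Real.log W) := by field_simp
        _ ≤ r / R₀ * S := this
    have h2 : r / R₀ * S ≤ S - S * D / R₀ := by
      have e : r / R₀ * S = S - S * (R₀ - r) / R₀ := by field_simp; ring
      rw [e]
      have hDr : D ≤ R₀ - r := by linarith
      have : S * D / R₀ ≤ S * (R₀ - r) / R₀ :=
        div_le_div_of_nonneg_right (mul_le_mul_of_nonneg_left hDr hS0) hR₀pos.le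
      linarith
    have h3 : κ * (2 * β - 1) ^ 2 ≤ S * D / R₀ := by
      calc κ * (2 * β - 1) ^ 2 ≤ κ * 1 := mul_le_mul_of_nonneg_left hx1 hκ0.le
        _ ≤ 3 / 10 * D / R₀ := by linarith
        _ ≤ S * D / R₀ := div_le_div_of_nonneg_right (mul_le_mul_of_nonneg_right hS3 hD0.le) hR₀pos.le
    have hrW : r * Real.log W ≤ S - κ * (2 * β - 1) ^ 2 := by linarith
    calc W ^ r = Real.exp (r * Real.log W) := by rw [Real.rpow_def_of_pos (by linarith), mul_comm]
      _ ≤ _ := Real.exp_le_exp.mpr hrW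

/-! ### Lemma 8: domination -/

set_option maxHeartbeats 800000 in
-- the assembly of Options A and B and the reflection; many case distinctions
/-- **Achlioptas–Peres, Lemma 8 (quantitative).** For `k ≥ 1024` there is a balancing `ε₀`
(`ε₀(2-ε₀)^{k-1} = 1`, `2/2^k ≤ ε₀ ≤ 2/2^k + 8k/4^k`; in `λ`-form `(1+λ₀)^{k-1}(1-λ₀) = 1`,
`λ₀ = 1 - ε₀`) and `κ > 0` such that for all `0 ≤ r ≤ L_k - 2δ_k`
(`L_k = 2^k log 2 - (k+1) log 2/2 - 1`, `δ_k = 15k²/2^k + E_k`) and all `α ∈ [0, 1]` the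
two-parameter second-moment ratio
`q(α) = min(F_{λ₀}(α), ((1-ε₀)/(1-ε₀/2))^k F_{λ₁}(α)) / F_{λ₀}(1/2)` (`λ₁ = 1 - ε₀/2`) satisfies
`0 ≤ q(α)` and `q(α)^r ≤ exp(spinRate(2α-1) - κ (2α-1)²)` — i.e. `g_r(α, ξ(α)) ≤ g_r(1/2, ε₀)
e^{-κ(2α-1)²}` with AP's `ξ`. [cite: AchlioptasPeres2004, Lemma 8 (arXiv:cs/0305009 p. 16), with Lemma 4, Corollary 2, Lemma 9] -/
theorem domination {k : ℕ} (hk : 1024 ≤ k) :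
    ∃ ε₀ : ℝ, 0 < ε₀ ∧ ε₀ < 1 ∧ ε₀ * (2 - ε₀) ^ (k - 1) = 1 ∧
      (1 + (1 - ε₀)) ^ (k - 1) * (1 - (1 - ε₀)) = 1 ∧
      2 / 2 ^ k ≤ ε₀ ∧ ε₀ ≤ 2 / 2 ^ k + 8 * k / 4 ^ k ∧
      0 < pairPoly k (1 - ε₀) (1 / 2) ∧
      ∃ κ : ℝ, 0 < κ ∧ ∀ r : ℝ, 0 ≤ r →
        r ≤ (2 ^ k * Real.log 2 - (k + 1) * Real.log 2 / 2 - 1) -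
          2 * (15 * k ^ 2 / 2 ^ k + ((k + 3) / 2 ^ k + 32 * k ^ 2 * (50 / 81) ^ k + 32 * k * (5 / 9) ^ k)) →
        ∀ α : ℝ, 0 ≤ α → α ≤ 1 →
          0 ≤ min (pairPoly k (1 - ε₀) α) (((1 - ε₀) / (1 - ε₀ / 2)) ^ k * pairPoly k (1 - ε₀ / 2) α) /
              pairPoly k (1 - ε₀) (1 / 2) ∧
          (min (pairPoly k (1 - ε₀) α) (((1 - ε₀) / (1 - ε₀ / 2)) ^ k * pairPoly k (1 - ε₀ / 2) α) /
              pairPoly k (1 - ε₀) (1 / 2)) ^ r ≤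
            Real.exp (spinRate (2 * α - 1) - κ * (2 * α - 1) ^ 2) := by
  obtain ⟨ε₀, hbal, hl, hu⟩ := exists_balance_eps (by omega : 4 ≤ k)
  have h2k : (0 : ℝ) < 2 ^ k := pow_pos two_pos k
  have h4k : (4 : ℝ) ^ k = 2 ^ k * 2 ^ k := by rw [← mul_pow]; norm_num
  have hk' : (1024 : ℝ) ≤ k := by exact_mod_cast hk
  have h16 : 16 * (k : ℝ) ≤ 2 ^ k := sixteen_mul_le_two_pow (by omega)
  have hl2 : Real.log 2 < 0.6931471808 := Real.log_two_lt_d9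
  have hl2l : 0.6931471803 < Real.log 2 := Real.log_two_gt_d9
  have hε₀ : 0 < ε₀ := lt_of_lt_of_le (by positivity) hl
  have hε₀4 : ε₀ ≤ 4 / 2 ^ k := by
    have h1 : 8 * (k : ℝ) / 4 ^ k ≤ 2 / 2 ^ k := by
      rw [h4k, div_le_div_iff₀ (by positivity) h2k]; nlinarith [h16, h2k]
    have e : (4 : ℝ) / 2 ^ k = 2 / 2 ^ k + 2 / 2 ^ k := by ring
    linarith
  have hε₀1 : ε₀ < 1 := by
    have : (4 : ℝ) / 2 ^ k ≤ 4 / 16384 := div_le_div_of_nonneg_left (by norm_num) (by norm_num) (by linarith)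
    linarith
  have hbal' : (1 + (1 - ε₀)) ^ (k - 1) * (1 - (1 - ε₀)) = 1 := by
    rw [show (1 : ℝ) + (1 - ε₀) = 2 - ε₀ by ring, show (1 : ℝ) - (1 - ε₀) = ε₀ by ring, mul_comm]
    exact hbal
  have hne0 : (1 + (1 - ε₀)) ^ k ≠ 1 := ne_of_gt (one_lt_pow₀ (by linarith) (by omega))
  have hF0h : 0 < pairPoly k (1 - ε₀) (1 / 2) := pairPoly_pos_of_half_le hne0 le_rfl
  have hρ0 : 0 ≤ ((1 - ε₀) / (1 - ε₀ / 2)) ^ k := pow_nonneg (div_nonneg (by linarith) (by linarith)) k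
  -- the Option-B threshold `R₀ = L_k - δ_k` and `κ`
  set E : ℝ := ((k : ℝ) + 3) / 2 ^ k + 32 * k ^ 2 * (50 / 81) ^ k + 32 * k * (5 / 9) ^ k with hE
  set D : ℝ := 15 * k ^ 2 / 2 ^ k + E with hD
  set R₀ : ℝ := (2 ^ k * Real.log 2 - (k + 1) * Real.log 2 / 2 - 1) - D with hR₀
  have hE3 : E ≤ 3 := errorE_le_three (by omega)
  have h15 : 15 * (k : ℝ) ^ 2 / 2 ^ k ≤ 1 := by
    rw [div_le_one h2k]; nlinarith [cube_le_two_pow (by omega : 10 ≤ k)]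
  have hD0 : 0 < D := by rw [hD]; positivity
  have hR₀2 : 2 ≤ R₀ := by
    rw [hR₀, hD]
    nlinarith [mul_nonneg (sub_nonneg.2 hl2l.le) h2k.le]
  have hR₀L : R₀ ≤ 2 ^ k * Real.log 2 := by
    rw [hR₀, hD]
    have : 0 ≤ 15 * (k : ℝ) ^ 2 / 2 ^ k := by positivity
    have : 0 ≤ E := by positivity
    nlinarith [Real.log_pos one_lt_two]
  have hR₀pos : 0 < R₀ := by linarith
  set κ : ℝ := min (1 / 4) (3 / 10 * D / R₀) with hκ
  have hκ0 : 0 < κ := lt_min (by norm_num) (by positivity)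
  have hκ4 : κ ≤ 1 / 4 := min_le_left _ _
  have hκR : κ ≤ 3 / 10 * D / R₀ := min_le_right _ _
  refine ⟨ε₀, hε₀, hε₀1, hbal, hbal', hl, hu, hF0h, κ, hκ0, ?_⟩
  intro r hr0 hr α hα0 hα1
  have hrR : r ≤ R₀ - D := by rw [hR₀, hD]; linarith
  have hr2 : r ≤ 2 ^ k * Real.log 2 := by linarith
  -- non-negativity of `q`
  have hq0 : ∀ β, 0 ≤ β → β ≤ 1 →
      0 ≤ min (pairPoly k (1 - ε₀) β) (((1 - ε₀) / (1 - ε₀ / 2)) ^ k * pairPoly k (1 - ε₀ / 2) β) /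
        pairPoly k (1 - ε₀) (1 / 2) := by
    intro β hβ0 hβ1
    apply div_nonneg _ hF0h.le
    exact le_min (pairPoly_nonneg k (by linarith) hβ0 hβ1)
      (mul_nonneg hρ0 (pairPoly_nonneg k (by linarith) hβ0 hβ1))
  -- the claim on `[1/2, 1]`
  have hhalf : ∀ β, 1 / 2 ≤ β → β ≤ 1 →
      (min (pairPoly k (1 - ε₀) β) (((1 - ε₀) / (1 - ε₀ / 2)) ^ k * pairPoly k (1 - ε₀ / 2) β) /
        pairPoly k (1 - ε₀) (1 / 2)) ^ r ≤ Real.exp (spinRate (2 * β - 1) - κ * (2 * β - 1) ^ 2) := by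
    intro β hβ hβ1
    have hqβ := hq0 β (by linarith) hβ1
    by_cases hβ9 : β ≤ 9 / 10
    · -- Option A (`[1/2, 9/10]`, parameter `ε₀`)
      have hcurv : ∀ a ∈ Icc (1 / 2 : ℝ) (9 / 10),
          r * ((k : ℝ) * (k - 1 : ℕ) * ((1 - (1 - ε₀)) ^ 4 * (2 * (1 - ε₀) + a * (1 - (1 - ε₀)) ^ 2) ^ (k - 2) -
            2 * (1 - (1 - ε₀)) ^ 2 * ((1 - ε₀) + a * (1 - (1 - ε₀))) ^ (k - 2) + a ^ (k - 2))) ≤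
            2 * pairPoly k (1 - ε₀) a :=
        fun a ha => curvature_le (by omega) hε₀.le hε₀4 hr0 hr2 ha
      have hA := pairPoly_div_rpow_le_exp_near_half (k := k) (by omega) (lam := 1 - ε₀) (by linarith)
        hbal' hr0 hcurv (α := β) ⟨hβ, hβ9⟩
      have hle : min (pairPoly k (1 - ε₀) β) (((1 - ε₀) / (1 - ε₀ / 2)) ^ k * pairPoly k (1 - ε₀ / 2) β) /
          pairPoly k (1 - ε₀) (1 / 2) ≤ pairPoly k (1 - ε₀) β / pairPoly k (1 - ε₀) (1 / 2) :=
        div_le_div_of_nonneg_right (min_le_left _ _) hF0h.le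
      calc _ ≤ (pairPoly k (1 - ε₀) β / pairPoly k (1 - ε₀) (1 / 2)) ^ r := Real.rpow_le_rpow hqβ hle hr0
        _ ≤ Real.exp (spinRate (2 * β - 1) - (2 * β - 1) ^ 2 / 4) := hA
        _ ≤ Real.exp (spinRate (2 * β - 1) - κ * (2 * β - 1) ^ 2) := by
            apply Real.exp_le_exp.mpr
            nlinarith [sq_nonneg (2 * β - 1), hκ4, hκ0]
    · -- Option B (`(9/10, 1]`, parameter `ε₀/2` and the truncation gain)
      push Not at hβ9
      have hle : min (pairPoly k (1 - ε₀) β) (((1 - ε₀) / (1 - ε₀ / 2)) ^ k * pairPoly k (1 - ε₀ / 2) β) /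
          pairPoly k (1 - ε₀) (1 / 2) ≤
          ((1 - ε₀) / (1 - ε₀ / 2)) ^ k * pairPoly k (1 - ε₀ / 2) β / pairPoly k (1 - ε₀) (1 / 2) :=
        div_le_div_of_nonneg_right (min_le_right _ _) hF0h.le
      exact (Real.rpow_le_rpow hqβ hle hr0).trans
        (optionB_rpow_le hk hbal hl hu hF0h hβ9.le hβ1 hr0 hrR hκ0 hκR)
  -- conclusion, reflecting `α < 1/2` to `1 - α`
  refine ⟨hq0 α hα0 hα1, ?_⟩
  by_cases hαh : 1 / 2 ≤ α
  · exact hhalf α hαh hα1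
  · push Not at hαh
    have hx : 0 ≤ 1 / 2 - α := by linarith
    have hF0m : pairPoly k (1 - ε₀) α ≤ pairPoly k (1 - ε₀) (1 - α) := by
      have := pairPoly_half_sub_le_half_add k (1 - ε₀) hx
      rwa [show (1 : ℝ) / 2 - (1 / 2 - α) = α by ring, show (1 : ℝ) / 2 + (1 / 2 - α) = 1 - α by ring] at this
    have hF1m : pairPoly k (1 - ε₀ / 2) α ≤ pairPoly k (1 - ε₀ / 2) (1 - α) := by
      have := pairPoly_half_sub_le_half_add k (1 - ε₀ / 2) hx
      rwa [show (1 : ℝ) / 2 - (1 / 2 - α) = α by ring, show (1 : ℝ) / 2 + (1 / 2 - α) = 1 - α by ring] at this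
    have hmono : min (pairPoly k (1 - ε₀) α) (((1 - ε₀) / (1 - ε₀ / 2)) ^ k * pairPoly k (1 - ε₀ / 2) α) /
          pairPoly k (1 - ε₀) (1 / 2) ≤
        min (pairPoly k (1 - ε₀) (1 - α)) (((1 - ε₀) / (1 - ε₀ / 2)) ^ k * pairPoly k (1 - ε₀ / 2) (1 - α)) /
          pairPoly k (1 - ε₀) (1 / 2) :=
      div_le_div_of_nonneg_right (min_le_min hF0m (mul_le_mul_of_nonneg_left hF1m hρ0)) hF0h.le
    have h := hhalf (1 - α) (by linarith) (by linarith)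
    have e : spinRate (2 * (1 - α) - 1) - κ * (2 * (1 - α) - 1) ^ 2 =
        spinRate (2 * α - 1) - κ * (2 * α - 1) ^ 2 := by
      rw [show (2 : ℝ) * (1 - α) - 1 = -(2 * α - 1) by ring, spinRate_neg]; ring
    rw [e] at h
    exact le_trans (Real.rpow_le_rpow (hq0 α hα0 hα1) hmono hr0) h

end RandomKSat

end Literature.Computability.Complexity

end
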